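import Summits.QuantumFields.BalabanUV.Beta.EriceRemainderEnclosureHistoryRenewalWitnessMonotone
import Summits.QuantumFields.BalabanUV.Beta.EriceRemainderEnclosureHistoryRenewalWitnessRate

/-!
# EriceRemainderEnclosureHistoryRenewalWitnessMonotoneRate — (E35f) the MONOTONE variant, part 2: both runs solve (0.20), the step family
# meets every binder of (E33g) AND is ANTITONE in every past coupling, and still — for all class constants and every `C`, `κ < 1` — a
# member beats `C·κ^j`: sign-coherent, bounded-variation memory does NOT rescue the class-uniform geometric shape

Cell `pub-balaban`, β-function sub-cell, BINDER row D4 «RemainderConst leaves for Bałaban's split» (`HOME/BINDER-OWNERS.md`; owner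
lineage `b2b-balaban-beta-an4`; this file by co-owner #2 lineage `b2b-balaban-beta-d4-p2`, generation 37), β-FLOW TEAM duty (1),
FREEZE (0) honoured (def-free; no new leaf, no new hypothesis shape — «antitone in every past coupling» is a plain proposition in the
statements).  Part 6 of station (E35) over part 5 `…WitnessMonotone` (steps, plateau runs, `step_values`) and part 3 `…WitnessRate`
(`staged_cost_le`, `exists_stages`).

HONEST FRAMING (page 1, verbatim and binding).  *"Discharging BetaPertH makes Bałaban's UV stability UNCONDITIONAL — a real
constructive-QFT result; it is NOT the continuum limit and NOT the Clay problem."*  THIS FILE DISCHARGES NOTHING OF THE KIND.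
[folklore] real analysis: a WITNESS about the cell's own NOT-IN-PRINT binders (GAPS G-t4-U2-1∕-2), never an assertion about Bałaban's
(1.22).  Row D4 class UNCHANGED (critical-path width 0; instance 0∕1; D4 DISCHARGE NO DATE); NOT B12 Thm 2, NOT BetaPertH, NOT continuum,
NOT Clay.  HONEST DEPENDENCY: continuum YM on T⁴ ⇐ BetaPertH ∧ nine spine estimates (0/9 proved); BetaPertH ⇐ (D1) ∧ (D4) ∧ CAP+tail;
G-an2-4 gates asym, D1 and NE2/3/4.

THE POINT (census sense (α)).  §1: along either run the step family reads `β_{k+1} = B₀ − Σ_t [k_t + 1 ≤ k]·ε_t` (`beta_prefix_eq`, from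
part 5's `step_values`), which is exactly the one-step drop of the plateau shifts, so BOTH explicit runs solve (0.20), lie in ]0,γ], are
pinned at `γ`, and `disc gA gB (k_s) = W(k_s + 1) ≥ ε_s` (`runs_step`).  §2 `binders_step`: `ScaleShiftRate c θ γ β`, `HistLipschitz`
with `Λ k (k − a_t) = ε_t·L_t` and rows `≤ Σ_t ε_t·L_t`, `b ≤ β`, and the EXTRA property: `β_{k+1}` antitone in every coordinate.  §3
`witness_core_step` packages it for every firing pattern; §4 `not_geometric_antitone`: for ALL `c θ γ b M` and EVERY `C`, `κ < 1` a
member of (E33g)'s class that is moreover coordinatewise antitone, with two pinned runs and `j ≤ K`, has `disc gA gB j > C·κ^j`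
(part 3's staged pattern and `exists_stages`; the row cost only gains the factor `(1+b)³`, `step_cost_le`).  READING: gen 36's
heuristic «sign-coherent memory telescopes across cutoffs ⟹ geometric» fails at the class-uniform level; what (E33e)'s clipped ramps
had was not monotonicity but saturation AWAY from the run points.  HONEST: each witness has finitely many live ages (its own fading
constant); what fails is UNIFORMITY over the class; nothing of [I] (1.22) asserted.

WHAT IS PROVED (0 `def`, 0 sorry; [folklore]).  §1 `beta_prefix_eq`, `runs_step`; §2 `binders_step`; §3 `witness_core_step`; §4
`step_cost_le`, `not_geometric_antitone`.
-/

noncomputable section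
open Finset Filter Topology

namespace Summit.QuantumFields.BalabanUV.Beta.EriceRemainderEnclosureHistoryRenewalWitnessMonotoneRate

open Literature.MathematicalPhysics.QuantumFieldTheory.Balaban1983to89
open Literature.MathematicalPhysics.QuantumFieldTheory.Balaban1983to89.FlowStep
open Literature.MathematicalPhysics.QuantumFieldTheory.Balaban1983to89.T4CouplingMatching
open Literature.MathematicalPhysics.QuantumFieldTheory.Balaban1983to89.T4BetaFlowWellPosed (one_div_sqrt_le)
open Literature.MathematicalPhysics.QuantumFieldTheory.Balaban1983to89.T4BetaFlowWellPosed.Sharpness (one_div_sqrt_pos one_div_one_div_sqrt_sq)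
open Summit.QuantumFields.BalabanUV.Beta.EriceRemainderEnclosureHistoryRenewalWitness
open Summit.QuantumFields.BalabanUV.Beta.EriceRemainderEnclosureHistoryRenewalWitnessMonotone
open Summit.QuantumFields.BalabanUV.Beta.EriceRemainderEnclosureHistoryRenewalWitnessRate (staged_cost_le exists_stages)

/-! ## §1 The family along the runs; both runs solve (0.20) -/

/-- **THE FAMILY ALONG A RUN.**  If a sequence of couplings `g` reads the step of every stage `t ≤ s` as `1` at the indices `≥ k_t + 1 − a_t`
and as `0` below (the conclusion of `step_values` for both runs), then `β_{k+1}(g_0, …, g_k) = B₀ − Σ_t [k_t + 1 ≤ k]·ε_t`. [folklore] -/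
theorem beta_prefix_eq {s : ℕ} {a k : ℕ → ℕ} {ε L q g : ℕ → ℝ} {B₀ : ℝ} {β : HBeta}
    (hβ : ∀ kk v, β kk v = B₀ - ∑ t ∈ range (s + 1),
      if a t ≤ kk then ε t * min 1 (max 0 (L t * (v ⟨kk - a t, Nat.sub_lt_succ kk (a t)⟩ - q t))) else 0)
    (hka : ∀ t, t ≤ s → a t ≤ k t + 1)
    (hg : ∀ t, t ≤ s → (∀ i, k t + 1 - a t ≤ i → min 1 (max 0 (L t * (g i - q t))) = 1) ∧
      (∀ i, i < k t + 1 - a t → min 1 (max 0 (L t * (g i - q t))) = 0)) (kk : ℕ) :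
    β kk (prefixOf g kk) = B₀ - ∑ t ∈ range (s + 1), if k t + 1 ≤ kk then ε t else 0 := by
  rw [hβ]
  congr 1
  refine sum_congr rfl fun t ht => ?_
  have hts : t ≤ s := Nat.lt_succ_iff.mp (mem_range.mp ht)
  have hkat := hka t hts
  simp only [prefixOf_apply]
  by_cases h1 : a t ≤ kk
  · rw [if_pos h1]
    by_cases h2 : k t + 1 ≤ kk
    · rw [if_pos h2, ((hg t hts).1 (kk - a t) (by omega)), mul_one]
    · rw [if_neg h2, ((hg t hts).2 (kk - a t) (by omega)), mul_zero]
  · rw [if_neg h1, if_neg (by omega)]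

/-- **BOTH RUNS SOLVE (0.20), LIE IN THE BOX, AND ARE PINNED** (step family): run A (`1∕(g^A_i)² = yA i`, cutoff `K = k_s + 1`) and run B
(`1∕(g^B_i)² = yB i`, cutoff `K + 1`) fire the plateau `Σ_t [k_t + 1 ≤ k]·ε_t` at row `k`, which is exactly the one-step drop of the
plateau shifts; values `≥ x⋆ = 1∕γ²`; `g^A_K = g^B_{K+1} = γ`. [folklore] -/
theorem runs_step {c θ γ b : ℝ} {s K : ℕ} {a k : ℕ → ℕ} {ε W PA PB Y yA yB η L q gA gB : ℕ → ℝ} {S B₀ xs Ytop : ℝ} {β : HBeta}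
    (hc : 0 < c) (hθ0 : 0 < θ) (hθ1 : θ ≤ 1) (hγ : 0 < γ) (hb : 0 < b)
    (hε : ∀ t, ε t = c * θ ^ (a t - 1) / (s + 1)) (hS : S = ∑ t ∈ range (s + 1), ε t) (hB : B₀ = b + S)
    (hx : xs = 1 / γ ^ 2) (hY : ∀ m : ℕ, Y m = xs + B₀ * m) (hK : K = k s + 1)
    (hW : ∀ i, W i = ∑ t ∈ range (s + 1), if i ≤ k t + 1 then ε t else 0)
    (hPA : ∀ i, PA i = ∑ t ∈ range (s + 1), ε t * ((K - max i (k t + 1) : ℕ) : ℝ))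
    (hPB : ∀ i, PB i = ∑ t ∈ range (s + 1), ε t * ((K + 1 - max i (k t + 1) : ℕ) : ℝ))
    (hT : Ytop = xs + (b + c) * (k s + 2) + b) (hyA : ∀ i, yA i = Y (K - i) - PA i) (hyB : ∀ i, yB i = Y (K + 1 - i) - PB i)
    (hη0 : η 0 = b) (hηs : ∀ t, η (t + 1) = ε t) (hL : ∀ t, L t = (1 + Ytop) ^ 3 / η t)
    (hq : ∀ t, q t = 1 / Real.sqrt (yB (k t + 1 - a t) + η t))
    (hgA : ∀ i, gA i = 1 / Real.sqrt (yA i)) (hgB : ∀ i, gB i = 1 / Real.sqrt (yB i))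
    (hβ : ∀ kk v, β kk v = B₀ - ∑ t ∈ range (s + 1),
      if a t ≤ kk then ε t * min 1 (max 0 (L t * (v ⟨kk - a t, Nat.sub_lt_succ kk (a t)⟩ - q t))) else 0)
    (ha0 : a 0 = k 0 + 1) (hak : ∀ t, t < s → k (t + 1) = k t + a (t + 1)) (hks : ∀ t, t ≤ s → k t ≤ k s)
    (hka : ∀ t, t ≤ s → a t ≤ k t + 1) (hεb : ∀ t, t ≤ s → ε t ≤ b) :
    RGEqH K β gA ∧ RGEqH (K + 1) β gB ∧ (∀ i, i ≤ K → 0 < gA i ∧ gA i ≤ γ) ∧ (∀ i, i ≤ K + 1 → 0 < gB i ∧ gB i ≤ γ) ∧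
      gA K = gB (K + 1) ∧ ε s ≤ disc gA gB (k s) := by
  obtain ⟨hxs, -, -, -, -, -, hYsucc⟩ := grid_bounds hc hθ0 hθ1 hγ hb hε hS hB hx hY (rfl : xs + (b + c) * (k s + 2) = _)
  obtain ⟨-, -, -, hstepA, hstepB, -, hcross, hPAz, hPBz⟩ := plateau_facts hc hθ0 hε hS hK hW hPA hPB hks
  obtain ⟨-, -, -, -, -, hW', hAbd, hBbd⟩ := run_facts hc hθ0 hθ1 hγ hb hε hS hB hx hY hK hW hPA hPB hT hyA hyB hks
  have hSV := fun t (ht : t ≤ s) =>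
    step_values hc hθ0 hθ1 hγ hb hε hS hB hx hY hK hW hPA hPB hT hyA hyB hη0 hηs hL hq hgA hgB ha0 hak hks hεb ht
  have hvalA : ∀ kk, β kk (prefixOf gA kk) = B₀ - ∑ t ∈ range (s + 1), if k t + 1 ≤ kk then ε t else 0 :=
    beta_prefix_eq hβ hka fun t ht => ⟨fun i hi => ((hSV t ht).1 i hi).1, fun i hi => ((hSV t ht).2 i hi).1⟩
  have hvalB : ∀ kk, β kk (prefixOf gB kk) = B₀ - ∑ t ∈ range (s + 1), if k t + 1 ≤ kk then ε t else 0 :=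
    beta_prefix_eq hβ hka fun t ht => ⟨fun i hi => ((hSV t ht).1 i hi).2, fun i hi => ((hSV t ht).2 i hi).2⟩
  have hyA0 : ∀ i, 0 ≤ yA i := fun i => hxs.le.trans (hAbd i).1
  have hyB0 : ∀ i, 0 ≤ yB i := fun i => hxs.le.trans (hBbd i).1
  refine ⟨fun kk hkk => ?_, fun kk hkk => ?_, fun i _ => ?_, fun i _ => ?_, ?_, ?_⟩
  · rw [hgA, hgA, one_div_one_div_sqrt_sq (hyA0 _), one_div_one_div_sqrt_sq (hyA0 _), hvalA, hyA, hyA,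
      show K - kk = (K - (kk + 1)) + 1 by omega, hYsucc]
    have := hstepA kk hkk; linarith
  · rw [hgB, hgB, one_div_one_div_sqrt_sq (hyB0 _), one_div_one_div_sqrt_sq (hyB0 _), hvalB, hyB, hyB,
      show K + 1 - kk = (K + 1 - (kk + 1)) + 1 by omega, hYsucc]
    have := hstepB kk (by omega); linarith
  · rw [hgA]; exact ⟨one_div_sqrt_pos (hxs.trans_le (hAbd i).1), one_div_sqrt_le hγ (hx ▸ (hAbd i).1)⟩
  · rw [hgB]; exact ⟨one_div_sqrt_pos (hxs.trans_le (hBbd i).1), one_div_sqrt_le hγ (hx ▸ (hBbd i).1)⟩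
  · rw [hgA, hgB, hyA, hyB, Nat.sub_self, show K + 1 - (K + 1) = 0 by omega, hPAz K le_rfl, hPBz (K + 1) le_rfl]
  · unfold disc
    rw [hgA, hgB, one_div_one_div_sqrt_sq (hyA0 _), one_div_one_div_sqrt_sq (hyB0 _), hW' (k s),
      abs_of_nonneg (W_bounds (k := k) hc hθ0 hε hS hW _).1]
    exact eps_le_W hc hθ0 hε hW le_rfl le_rfl

/-! ## §2 The binder list, and the extra binder: ANTITONE history dependence -/

/-- **NE4 AS TYPED, HISTORY MODULI WITH FINITE ROWS, SIGN ∕ FLOOR, AND COORDINATEWISE ANTITONE MEMORY** for the step family: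
`ScaleShiftRate c θ γ β`; `HistLipschitz Λ γ β` with `Λ k (k − a_t) = ε_t·L_t ≥ 0` and rows `≤ Σ_t ε_t·L_t`; `b ≤ β` on every box; and
`β_{k+1}` is ANTITONE in every past coupling: `p ≤ q` coordinatewise ⟹ `β_{k+1}(q) ≤ β_{k+1}(p)` (each profile `−ε_t·step_t` is
non-increasing, of total variation `ε_t ≤ cθ^{a_t−1}`). [folklore] -/
theorem binders_step {c θ γ b : ℝ} {s : ℕ} {a : ℕ → ℕ} {ε η L q : ℕ → ℝ} {S B₀ Ytop : ℝ} {β : HBeta} {Λ : ℕ → ℕ → ℝ}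
    (hc : 0 < c) (hθ0 : 0 < θ) (hb : 0 < b)
    (hε : ∀ t, ε t = c * θ ^ (a t - 1) / (s + 1)) (hS : S = ∑ t ∈ range (s + 1), ε t) (hB : B₀ = b + S)
    (hη0 : η 0 = b) (hηs : ∀ t, η (t + 1) = ε t) (hL : ∀ t, L t = (1 + Ytop) ^ 3 / η t) (hYtop : 0 ≤ Ytop)
    (hβ : ∀ kk v, β kk v = B₀ - ∑ t ∈ range (s + 1),
      if a t ≤ kk then ε t * min 1 (max 0 (L t * (v ⟨kk - a t, Nat.sub_lt_succ kk (a t)⟩ - q t))) else 0)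
    (hΛ : ∀ kk i, Λ kk i = ∑ t ∈ range (s + 1), if i = kk - a t then (if a t ≤ kk then ε t * L t else 0) else 0) :
    ScaleShiftRate c θ γ β ∧ HistLipschitz Λ γ β ∧ (∀ kk i, i ≤ kk → 0 ≤ Λ kk i) ∧
      (∀ kk, ∑ i ∈ range (kk + 1), Λ kk i ≤ ∑ t ∈ range (s + 1), ε t * L t) ∧
      BetaLowerH 0 γ β ∧ EventualLowerH b γ 0 β ∧
      (∀ kk (p w : Fin (kk + 1) → ℝ), (∀ i, p i ≤ w i) → β kk w ≤ β kk p) := by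
  have hp := eps_pos hc hθ0 hε
  have hLpos : ∀ t, 0 ≤ L t := fun t => by
    rw [hL]; refine div_nonneg (by positivity) ?_
    cases t with
    | zero => rw [hη0]; exact hb.le
    | succ t => rw [hηs]; exact (hp t).le
  refine ⟨?_, ?_, fun kk i _ => ?_, fun kk => ?_, ?_, ?_, fun kk p w hpw => ?_⟩
  · -- ScaleShiftRate
    intro kk w _hw
    rw [hβ, hβ, sub_sub_sub_cancel_left, ← sum_sub_distrib]
    calc |∑ t ∈ range (s + 1), ((if a t ≤ kk then ε t * min 1 (max 0 (L t *
              (Fin.tail w ⟨kk - a t, Nat.sub_lt_succ kk (a t)⟩ - q t))) else 0) -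
            (if a t ≤ kk + 1 then ε t * min 1 (max 0 (L t *
              (w ⟨kk + 1 - a t, Nat.sub_lt_succ (kk + 1) (a t)⟩ - q t))) else 0))|
        ≤ ∑ t ∈ range (s + 1), |(if a t ≤ kk then ε t * min 1 (max 0 (L t *
              (Fin.tail w ⟨kk - a t, Nat.sub_lt_succ kk (a t)⟩ - q t))) else 0) -
            (if a t ≤ kk + 1 then ε t * min 1 (max 0 (L t *
              (w ⟨kk + 1 - a t, Nat.sub_lt_succ (kk + 1) (a t)⟩ - q t))) else 0)| := abs_sum_le_sum_abs _ _
      _ ≤ ∑ _t ∈ range (s + 1), c * θ ^ kk / (s + 1) := by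
          refine sum_le_sum fun t _ => ?_
          by_cases h1 : a t ≤ kk
          · have e : Fin.tail w ⟨kk - a t, Nat.sub_lt_succ kk (a t)⟩ = w ⟨kk + 1 - a t, Nat.sub_lt_succ (kk + 1) (a t)⟩ := by
              simp only [Fin.tail, Fin.succ_mk]
              exact congrArg w (Fin.ext (by simp; omega))
            rw [if_pos h1, if_pos (by omega), e, sub_self, abs_zero]; positivity
          · by_cases h2 : a t = kk + 1
            · have hεt : ε t = c * θ ^ kk / (s + 1) := by rw [hε, h2, Nat.add_sub_cancel]
              rw [if_neg h1, if_pos h2.le, zero_sub, abs_neg, abs_of_nonneg (mul_nonneg (hp t).le (step_nonneg _ _ _)), hεt]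
              exact mul_le_of_le_one_right (by positivity) (step_le_one _ _ _)
            · rw [if_neg h1, if_neg (by omega), sub_zero, abs_zero]; positivity
      _ = c * θ ^ kk := by rw [sum_const, card_range, nsmul_eq_mul]; push_cast; field_simp
  · -- HistLipschitz
    intro kk p w _ _
    have hR : ∑ i : Fin (kk + 1), Λ kk i * |p i - w i| = ∑ t ∈ range (s + 1),
        if a t ≤ kk then ε t * L t * |p ⟨kk - a t, Nat.sub_lt_succ kk (a t)⟩ - w ⟨kk - a t, Nat.sub_lt_succ kk (a t)⟩| else 0 := by
      simp_rw [hΛ, sum_mul]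
      rw [sum_comm]
      refine sum_congr rfl fun t _ => ?_
      rw [Finset.sum_eq_single ⟨kk - a t, Nat.sub_lt_succ kk (a t)⟩]
      · rw [if_pos rfl]
        split_ifs
        · rfl
        · exact zero_mul _
      · intro i _ hi
        rw [if_neg (fun h => hi (Fin.ext h)), zero_mul]
      · intro h; exact absurd (mem_univ _) h
    rw [hR, hβ, hβ, sub_sub_sub_cancel_left, ← sum_sub_distrib]
    refine (abs_sum_le_sum_abs _ _).trans (sum_le_sum fun t _ => ?_)
    split_ifs with hat
    · rw [← mul_sub, abs_mul, abs_of_nonneg (hp t).le, mul_assoc]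
      refine mul_le_mul_of_nonneg_left ?_ (hp t).le
      rw [abs_sub_comm (p _) (w _)]
      exact abs_step_sub_step_le (hLpos t) _ _ _
    · rw [sub_self, abs_zero]
  · rw [hΛ]
    exact sum_nonneg fun t _ => by split_ifs <;> first | exact mul_nonneg (hp t).le (hLpos t) | exact le_rfl
  · simp_rw [hΛ]
    rw [sum_comm]
    refine sum_le_sum fun t _ => ?_
    rw [sum_ite_eq' (range (kk + 1)) (kk - a t), if_pos (mem_range.mpr (Nat.sub_lt_succ kk (a t)))]
    split_ifs
    · exact le_rfl
    · exact mul_nonneg (hp t).le (hLpos t)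
  · intro kk v _
    have key : ∑ t ∈ range (s + 1), (if a t ≤ kk then
        ε t * min 1 (max 0 (L t * (v ⟨kk - a t, Nat.sub_lt_succ kk (a t)⟩ - q t))) else 0) ≤ S := by
      rw [hS]; refine sum_le_sum fun t _ => ?_
      split_ifs
      · exact mul_le_of_le_one_right (hp t).le (step_le_one _ _ _)
      · exact (hp t).le
    rw [hβ]; linarith
  · intro kk v _ _
    have key : ∑ t ∈ range (s + 1), (if a t ≤ kk then
        ε t * min 1 (max 0 (L t * (v ⟨kk - a t, Nat.sub_lt_succ kk (a t)⟩ - q t))) else 0) ≤ S := by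
      rw [hS]; refine sum_le_sum fun t _ => ?_
      split_ifs
      · exact mul_le_of_le_one_right (hp t).le (step_le_one _ _ _)
      · exact (hp t).le
    rw [hβ]; linarith
  · -- antitone
    rw [hβ, hβ]
    refine sub_le_sub_left (sum_le_sum fun t _ => ?_) _
    split_ifs
    · exact mul_le_mul_of_nonneg_left (step_mono (hLpos t) (hpw _)) (hp t).le
    · exact le_rfl

/-! ## §3 The monotone witness, packaged -/

/-- **THE MONOTONE β-LEVEL WITNESS (core form).**  As (E35b) `witness_core`, for every firing pattern, but with STEP profiles: the
family `β_{k+1}(v) = B₀ − Σ_t [a_t ≤ k]·ε_t·step_t(v_{k−a_t})` is additionally ANTITONE in every past coupling; both runs carry the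
plateau shifts and solve (0.20); the whole binder list of (E33g) holds with rows
`≤ (1 + 1∕γ² + (b+c)(k_s+2) + b)³·(ε_0∕b + Σ_{t<s} θ^{a_{t+1}−1}∕θ^{a_t−1})`, and `disc gA gB (k_s) ≥ ε_s`. [cite: Balaban1987RG1, (0.20) p.256 and §5 p.298] -/
theorem witness_core_step {c θ γ b : ℝ} (hc : 0 < c) (hθ0 : 0 < θ) (hθ1 : θ ≤ 1) (hγ : 0 < γ) (hb : 0 < b)
    {s : ℕ} {a k : ℕ → ℕ} (ha0 : a 0 = k 0 + 1) (hak : ∀ t, t < s → k (t + 1) = k t + a (t + 1))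
    (hεb : ∀ t, t ≤ s → c * θ ^ (a t - 1) / (s + 1) ≤ b) :
    ∃ (β : HBeta) (Λ : ℕ → ℕ → ℝ) (gA gB : ℕ → ℝ),
      RGEqH (k s + 1) β gA ∧ RGEqH (k s + 1 + 1) β gB ∧
      (∀ i, i ≤ k s + 1 → 0 < gA i ∧ gA i ≤ γ) ∧ (∀ i, i ≤ k s + 1 + 1 → 0 < gB i ∧ gB i ≤ γ) ∧
      gA (k s + 1) = gB (k s + 1 + 1) ∧
      ScaleShiftRate c θ γ β ∧ HistLipschitz Λ γ β ∧ (∀ kk i, i ≤ kk → 0 ≤ Λ kk i) ∧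
      (∀ kk, ∑ i ∈ range (kk + 1), Λ kk i ≤
        (1 + (1 / γ ^ 2 + (b + c) * (k s + 2) + b)) ^ 3 *
          (c * θ ^ (a 0 - 1) / (s + 1) / b + ∑ t ∈ range s, θ ^ (a (t + 1) - 1) / θ ^ (a t - 1))) ∧
      BetaLowerH 0 γ β ∧ EventualLowerH b γ 0 β ∧
      (∀ kk (p w : Fin (kk + 1) → ℝ), (∀ i, p i ≤ w i) → β kk w ≤ β kk p) ∧
      c * θ ^ (a s - 1) / (s + 1) ≤ disc gA gB (k s) := by
  -- pattern consequences
  have hmono : ∀ n t, t + n ≤ s → k t ≤ k (t + n) := by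
    intro n
    induction n with
    | zero => intro t _; simp
    | succ n ih =>
      intro t h
      have h1 := ih t (by omega)
      have h2 := hak (t + n) (by omega)
      rw [← add_assoc, h2]; omega
  have hks : ∀ t, t ≤ s → k t ≤ k s := fun t ht => by
    have := hmono (s - t) t (by omega); rwa [Nat.add_sub_cancel' ht] at this
  have hka : ∀ t, t ≤ s → a t ≤ k t + 1 := by
    intro t ht
    cases t with
    | zero => omega
    | succ t => have := hak t (by omega); omega
  -- the data, by defining equations
  obtain ⟨ε, hε⟩ : ∃ ε : ℕ → ℝ, ∀ t, ε t = c * θ ^ (a t - 1) / (s + 1) := ⟨_, fun _ => rfl⟩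
  obtain ⟨S, hS⟩ : ∃ S : ℝ, S = ∑ t ∈ range (s + 1), ε t := ⟨_, rfl⟩
  obtain ⟨B₀, hB⟩ : ∃ B₀ : ℝ, B₀ = b + S := ⟨_, rfl⟩
  obtain ⟨xs, hx⟩ : ∃ xs : ℝ, xs = 1 / γ ^ 2 := ⟨_, rfl⟩
  obtain ⟨Y, hY⟩ : ∃ Y : ℕ → ℝ, ∀ m : ℕ, Y m = xs + B₀ * m := ⟨_, fun _ => rfl⟩
  obtain ⟨W, hW⟩ : ∃ W : ℕ → ℝ, ∀ i, W i = ∑ t ∈ range (s + 1), if i ≤ k t + 1 then ε t else 0 := ⟨_, fun _ => rfl⟩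
  obtain ⟨PA, hPA⟩ : ∃ PA : ℕ → ℝ, ∀ i, PA i = ∑ t ∈ range (s + 1), ε t * ((k s + 1 - max i (k t + 1) : ℕ) : ℝ) :=
    ⟨_, fun _ => rfl⟩
  obtain ⟨PB, hPB⟩ : ∃ PB : ℕ → ℝ, ∀ i, PB i = ∑ t ∈ range (s + 1), ε t * ((k s + 1 + 1 - max i (k t + 1) : ℕ) : ℝ) :=
    ⟨_, fun _ => rfl⟩
  obtain ⟨Ytop, hT⟩ : ∃ Ytop : ℝ, Ytop = xs + (b + c) * (k s + 2) + b := ⟨_, rfl⟩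
  obtain ⟨yA, hyA⟩ : ∃ yA : ℕ → ℝ, ∀ i, yA i = Y (k s + 1 - i) - PA i := ⟨_, fun _ => rfl⟩
  obtain ⟨yB, hyB⟩ : ∃ yB : ℕ → ℝ, ∀ i, yB i = Y (k s + 1 + 1 - i) - PB i := ⟨_, fun _ => rfl⟩
  obtain ⟨η, hη0, hηs⟩ : ∃ η : ℕ → ℝ, η 0 = b ∧ ∀ t, η (t + 1) = ε t :=
    ⟨fun t => Nat.casesOn t b (fun t' => ε t'), rfl, fun _ => rfl⟩
  obtain ⟨L, hL⟩ : ∃ L : ℕ → ℝ, ∀ t, L t = (1 + Ytop) ^ 3 / η t := ⟨_, fun _ => rfl⟩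
  obtain ⟨q, hq⟩ : ∃ q : ℕ → ℝ, ∀ t, q t = 1 / Real.sqrt (yB (k t + 1 - a t) + η t) := ⟨_, fun _ => rfl⟩
  obtain ⟨gA, hgA⟩ : ∃ gA : ℕ → ℝ, ∀ i, gA i = 1 / Real.sqrt (yA i) := ⟨_, fun _ => rfl⟩
  obtain ⟨gB, hgB⟩ : ∃ gB : ℕ → ℝ, ∀ i, gB i = 1 / Real.sqrt (yB i) := ⟨_, fun _ => rfl⟩
  obtain ⟨β, hβ⟩ : ∃ β : HBeta, ∀ kk v, β kk v = B₀ - ∑ t ∈ range (s + 1),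
      if a t ≤ kk then ε t * min 1 (max 0 (L t * (v ⟨kk - a t, Nat.sub_lt_succ kk (a t)⟩ - q t))) else 0 :=
    ⟨fun kk v => _, fun _ _ => rfl⟩
  obtain ⟨Λ, hΛ⟩ : ∃ Λ : ℕ → ℕ → ℝ, ∀ kk i, Λ kk i = ∑ t ∈ range (s + 1),
      if i = kk - a t then (if a t ≤ kk then ε t * L t else 0) else 0 := ⟨_, fun _ _ => rfl⟩
  have hεb' : ∀ t, t ≤ s → ε t ≤ b := fun t ht => (hε t).symm ▸ hεb t ht
  obtain ⟨hxs, -, -, -, -, -, -⟩ := grid_bounds hc hθ0 hθ1 hγ hb hε hS hB hx hY (rfl : xs + (b + c) * (k s + 2) = _)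
  have hYtop : 0 ≤ Ytop := by rw [hT]; positivity
  obtain ⟨hRA, hRB, hAbox, hBbox, hpin, hdisc⟩ :=
    runs_step hc hθ0 hθ1 hγ hb hε hS hB hx hY rfl hW hPA hPB hT hyA hyB hη0 hηs hL hq hgA hgB hβ ha0 hak hks hka hεb'
  obtain ⟨hSSR, hHL, hΛ0, hrows, hsign, hfloor, hanti⟩ := binders_step (γ := γ) hc hθ0 hb hε hS hB hη0 hηs hL hYtop hβ hΛ
  -- the stage cost, explicitly
  have hcost : ∑ t ∈ range (s + 1), ε t * L t = (1 + (1 / γ ^ 2 + (b + c) * (k s + 2) + b)) ^ 3 *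
      (c * θ ^ (a 0 - 1) / (s + 1) / b + ∑ t ∈ range s, θ ^ (a (t + 1) - 1) / θ ^ (a t - 1)) := by
    have hp := eps_pos hc hθ0 hε
    rw [sum_range_succ', hL, hη0, mul_add, mul_sum, add_comm]
    congr 1
    · rw [hε, hT, hx]; ring
    · refine sum_congr rfl fun t _ => ?_
      rw [hL, hηs, hT, hx, hε, hε]
      have h1 : (0 : ℝ) < θ ^ (a t - 1) := by positivity
      have h2 : (0 : ℝ) < (s : ℝ) + 1 := by positivity
      field_simp
  refine ⟨β, Λ, gA, gB, hRA, hRB, hAbox, hBbox, hpin, hSSR, hHL, hΛ0, fun kk => (hrows kk).trans (le_of_eq hcost), hsign, hfloor,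
    hanti, ?_⟩
  rw [← hε]; exact hdisc

/-! ## §4 The β-level cell with ANTITONE memory: still no class-uniform geometric rate -/

/-- The staged row cost of the step family: `(1 + 1∕γ² + (b+c)(k_s+2) + b)³ ≤ (1+b)³(1 + 1∕γ² + (b+c)(k_s+2))³`, hence (part 3
`staged_cost_le`) at most `(1+b)³(1 + 1∕γ² + 3(b+c))³(c∕b+1)(s+1)^{10}θ^s`. [folklore] -/
theorem step_cost_le {c θ γ b : ℝ} (hc : 0 < c) (hθ0 : 0 < θ) (hθ1 : θ ≤ 1) (hγ : 0 < γ) (hb : 0 < b) (s : ℕ)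
    {a k : ℕ → ℕ} (ha : ∀ t, a t = 2 * s * t + s + 1) (hk : ∀ t, k t = s * t * (t + 1) + (s + 1) * t + s) :
    (1 + (1 / γ ^ 2 + (b + c) * (k s + 2) + b)) ^ 3 *
        (c * θ ^ (a 0 - 1) / (s + 1) / b + ∑ t ∈ range s, θ ^ (a (t + 1) - 1) / θ ^ (a t - 1))
      ≤ (1 + b) ^ 3 * ((1 + 1 / γ ^ 2 + 3 * (b + c)) ^ 3 * (c / b + 1)) * ((s : ℝ) + 1) ^ 10 * θ ^ s := by
  have hfac0 : ∀ X : ℝ, 0 ≤ X → (1 + (X + b)) ^ 3 ≤ (1 + b) ^ 3 * (1 + X) ^ 3 := fun X hX => by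
    rw [← mul_pow]
    refine pow_le_pow_left₀ (by linarith) ?_ 3
    nlinarith [mul_nonneg hb.le hX]
  have hfac := hfac0 (1 / γ ^ 2 + (b + c) * (k s + 2)) (by positivity)
  have hG0 : 0 ≤ c * θ ^ (a 0 - 1) / (s + 1) / b + ∑ t ∈ range s, θ ^ (a (t + 1) - 1) / θ ^ (a t - 1) :=
    add_nonneg (div_nonneg (div_nonneg (mul_nonneg hc.le (pow_nonneg hθ0.le _)) (by positivity)) hb.le)
      (sum_nonneg fun t _ => div_nonneg (pow_nonneg hθ0.le _) (pow_nonneg hθ0.le _))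
  have h1 := mul_le_mul_of_nonneg_right hfac hG0
  have h2 := mul_le_mul_of_nonneg_left (staged_cost_le hc hθ0 hθ1 hγ hb s ha hk) (pow_nonneg (by linarith : (0 : ℝ) ≤ 1 + b) 3)
  rw [mul_assoc] at h1
  refine h1.trans (h2.trans (le_of_eq ?_))
  ring



/-- **NO CLASS-UNIFORM GEOMETRIC TWO-RUN MATCHING RATE EVEN WITH COORDINATEWISE ANTITONE MEMORY (E35f).**  For ALL class constants
`c > 0`, `0 < θ < 1`, `γ > 0`, `b > 0`, `M > 0` and EVERY `C`, `0 ≤ κ < 1` there are `β`, `Λ`, `K`, two pinned runs of (0.20) in the box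
and `j ≤ K` with the WHOLE binder list of (E33g) `disc_le_sqrt_uniform_sign` (rows `≤ M`), with IN ADDITION `β_{k+1}` ANTITONE in every
past coupling (`p ≤ q` coordinatewise ⟹ `β_{k+1}(q) ≤ β_{k+1}(p)`: sign-coherent memory of bounded variation — each age profile is one
non-increasing step of height `≤ cθ^{a−1}`), and `disc gA gB j > C·κ^j`.  So the «sign-coherent ∕ monotone memory telescopes across
cutoffs ⟹ geometric» heuristic of gen 36's research note does NOT hold at the class-uniform level: the adversary is the PLACEMENT of the
step between the two runs' matched couplings, not oscillation.  WITNESS: part 1's staged pattern with step profiles (§3).  HONEST: a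
witness about NOT-IN-PRINT binders; each witness has finitely many live ages; nothing of [I] (1.22) asserted; NOT B12 Thm 2, NOT
BetaPertH, NOT continuum, NOT Clay. [cite: Balaban1987RG1, (0.20) p.256 and §5 p.298] -/
theorem not_geometric_antitone {c θ γ b M : ℝ} (hc : 0 < c) (hθ0 : 0 < θ) (hθ1 : θ < 1) (hγ : 0 < γ) (hb : 0 < b) (hM : 0 < M)
    (C κ : ℝ) (hκ0 : 0 ≤ κ) (hκ1 : κ < 1) :
    ∃ (β : HBeta) (Λ : ℕ → ℕ → ℝ) (K : ℕ) (gA gB : ℕ → ℝ) (j : ℕ),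
      RGEqH K β gA ∧ RGEqH (K + 1) β gB ∧
      (∀ i, i ≤ K → 0 < gA i ∧ gA i ≤ γ) ∧ (∀ i, i ≤ K + 1 → 0 < gB i ∧ gB i ≤ γ) ∧ gA K = gB (K + 1) ∧
      ScaleShiftRate c θ γ β ∧ HistLipschitz Λ γ β ∧ (∀ k i, i ≤ k → 0 ≤ Λ k i) ∧
      (∀ k, ∑ i ∈ range (k + 1), Λ k i ≤ M) ∧ BetaLowerH 0 γ β ∧ EventualLowerH b γ 0 β ∧
      (∀ k (p w : Fin (k + 1) → ℝ), (∀ i, p i ≤ w i) → β k w ≤ β k p) ∧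
      j ≤ K ∧ C * κ ^ j < disc gA gB j := by
  obtain ⟨s, h1, h2, h3, h4⟩ := exists_stages (A := (1 + b) ^ 3 * ((1 + 1 / γ ^ 2 + 3 * (b + c)) ^ 3 * (c / b + 1))) (C := C)
    hc hθ0 hθ1 hb hM hκ0 hκ1
  obtain ⟨a, ha⟩ : ∃ a : ℕ → ℕ, ∀ t, a t = 2 * s * t + s + 1 := ⟨_, fun _ => rfl⟩
  obtain ⟨k, hk⟩ : ∃ k : ℕ → ℕ, ∀ t, k t = s * t * (t + 1) + (s + 1) * t + s := ⟨_, fun _ => rfl⟩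
  have ha0 : a 0 = k 0 + 1 := by rw [ha, hk]; ring
  have hak : ∀ t, t < s → k (t + 1) = k t + a (t + 1) := fun t _ => by rw [hk, hk, ha]; ring
  have hεb : ∀ t, t ≤ s → c * θ ^ (a t - 1) / (s + 1) ≤ b := by
    intro t _
    have hst : s ≤ a t - 1 := by rw [ha, Nat.add_sub_cancel]; exact Nat.le_add_left s _
    have hle : c * θ ^ (a t - 1) ≤ c * θ ^ s := mul_le_mul_of_nonneg_left (pow_le_pow_of_le_one hθ0.le hθ1.le hst) hc.le
    have hd : c * θ ^ (a t - 1) / (s + 1) ≤ c * θ ^ (a t - 1) :=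
      div_le_self (by positivity) (by linarith [(Nat.cast_nonneg s : (0 : ℝ) ≤ s)])
    linarith
  obtain ⟨β, Λ, gA, gB, hRA, hRB, hAbox, hBbox, hpin, hSSR, hHL, hΛ0, hrows, hsign, hfloor, hanti, hdisc⟩ :=
    witness_core_step hc hθ0 hθ1.le hγ hb ha0 hak hεb
  refine ⟨β, Λ, k s + 1, gA, gB, k s, hRA, hRB, hAbox, hBbox, hpin, hSSR, hHL, hΛ0, fun kk => ?_, hsign, hfloor, hanti,
    Nat.le_succ _, ?_⟩
  · exact (hrows kk).trans ((step_cost_le hc hθ0 hθ1.le hγ hb s ha hk).trans h3)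
  · refine lt_of_lt_of_le ?_ hdisc
    have has : a s - 1 = 2 * s * s + s := by rw [ha, Nat.add_sub_cancel]
    rw [has]
    have hpos : (0 : ℝ) < c * θ ^ (2 * s * s + s) / (s + 1) := by positivity
    rcases le_or_gt C 0 with hC | hC
    · exact lt_of_le_of_lt (mul_nonpos_of_nonpos_of_nonneg hC (pow_nonneg hκ0 _)) hpos
    · have hss : s ≤ s * s := Nat.le_mul_self s
      have hks3 : s * (s * s) ≤ k s := by rw [hk]; nlinarith [Nat.zero_le s, Nat.zero_le (s * s)]
      have hexp : s + (2 * s * s + s) ≤ 4 * (s * s) := by nlinarith [hss]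
      calc C * κ ^ k s ≤ C * κ ^ (s * (s * s)) := mul_le_mul_of_nonneg_left (pow_le_pow_of_le_one hκ0 hκ1.le hks3) hC.le
        _ = C * (κ ^ s) ^ (s * s) := by rw [pow_mul]
        _ ≤ C * (θ ^ 4) ^ (s * s) := mul_le_mul_of_nonneg_left (pow_le_pow_left₀ (pow_nonneg hκ0 s) h1 _) hC.le
        _ = C * θ ^ (4 * (s * s)) := by rw [← pow_mul]
        _ ≤ C * θ ^ (s + (2 * s * s + s)) := mul_le_mul_of_nonneg_left (pow_le_pow_of_le_one hθ0.le hθ1.le hexp) hC.le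
        _ = (C * ((s : ℝ) + 1) * θ ^ s) * (θ ^ (2 * s * s + s) / ((s : ℝ) + 1)) := by
            rw [pow_add]; field_simp
        _ < c * (θ ^ (2 * s * s + s) / ((s : ℝ) + 1)) := mul_lt_mul_of_pos_right h2 (by positivity)
        _ = c * θ ^ (2 * s * s + s) / (s + 1) := by ring

end Summit.QuantumFields.BalabanUV.Beta.EriceRemainderEnclosureHistoryRenewalWitnessMonotoneRate

end
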